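import Summits.HodgeConjecture.HodgeConjecture.Theorems.PadicSemiregularLiftHodgeFermatVarietiesExistsFibreOfNotPaired
import Summits.HodgeConjecture.HodgeConjecture.Theorems.PadicSemiregularLiftHodgeFermatVarietiesSigmaFiveOfFibre
import Summits.HodgeConjecture.HodgeConjecture.Theorems.PadicSemiregularLiftHodgeFermatVarietiesReachCoprimeSix
import Summits.HodgeConjecture.HodgeConjecture.Theorems.PadicSemiregularLiftHodgeFermatVarietiesDoublingHodge
import HarnessLib

/-!
# The Hodge sextuples at a level prime to `6` and HC for the Fermat fourfolds `X⁴ₘ`, `(m, 6) = 1` — stub S16 `stub_fourfoldCoprimeSix` of line `cancel-by-any-claim-lattice`, crux `HodgeFermatVarieties` (stmt-HodgeConjecture-1334)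

Crux `HodgeFermatVarieties` (stmt-HodgeConjecture-1334), line `cancel-by-any-claim-lattice`, stub S16
`stub_fourfoldCoprimeSix` (the assembled classification of the lead's programme S16, lead c4) together with
its importable Hodge-conjecture pay-off. Everything here is PROVED (no `sorry`, no new definition, no new
named fact): the file only assembles the three LANDED pieces of the programme,

* `PairedNull.stub_exists_fibre_of_not_paired` (`…ExistsFibreOfNotPaired`, S16-L2: a non-paired Hodge
  sextuple at a level `m` prime to `6`, `25 ∤ m`, `35 ∤ m`, contains four of the five points of a
  progression `{A + j(m/5)}` with `5A ≠ 0`, and `5 ∣ m`),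
* `CoprimeSix.stub_sigmaFive_of_fibre` (`…SigmaFiveOfFibre`, S16-L3: four progression points force
  three pairs or Aoki's `σ_{5,A} = {A + j(m/5) : j < 5} + {-5A}`),
* `CoprimeSix.stub_reach_of_pairedOrSigmaFive` (`…ReachCoprimeSix`, S16-R: both shapes are ℤ-reachable
  from the printed supply at their own level),

into:

* `exists_pairs_of_count_symm` — at a level prime to `6` (indeed at any odd level) a Hodge multiset with
  symmetric multiplicities `count x s = count (-x) s` is a juxtaposition of pairs `Q + (-Q)`, `Q`
  zero-free (no entry is self-paired: `a = -a` gives `2a = 0`, `a = 0`, excluded by zero-freeness);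
* `stub_fourfoldCoprimeSix` (registered signature) and its named-hypotheses form `classification` —
  **THE HODGE SEXTUPLES OF `ℤ/m`, `(m, 6) = 1`, `25 ∤ m`, `35 ∤ m`: three pairs `{a, -a}` (`a ≠ 0`), or
  `5 ∣ m` and `s = σ_{5,A} = {A + j(m/5) : j < 5} + {-5A}` with `5A ≠ 0`** (symmetric multiplicities:
  pairs; otherwise S16-L2 then S16-L3);
* `reach_sextuple_coprime_six` — hence every Hodge sextuple of such a level is reachable at its own
  level (S16-R);
* `allUnit_sextuple_paired` — a Hodge sextuple of units at such a level is three pairs (the entry `-5A`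
  of `σ_{5,A}` is never a unit when `5 ∣ m`);
* `hodgeConjectureFor_fourfold_coprime_six` — **HC FOR EVERY SMOOTH PROJECTIVE COMPLEX FERMAT FOURFOLD
  `X⁴ₘ` OF DEGREE `m` PRIME TO `6` WITH `25 ∤ m`, `35 ∤ m`** (all `(m, 30) = 1`; all `5n` with `n` prime
  to `210`: `5, 35` excluded but `55, 65, 85, 95, 115, …, 605 = 5·11², 715 = 5·11·13, …`), granted
  exactly the hypotheses of every earlier pay-off of the line: the printed facts S0 (Aoki 1987 Thm 1-4
  (i),(ii), Thm 1-1, Thm 2-1; Aoki–Shioda 1983 (2.1)) and the statements of the stubs S2↑/S2↓ (claim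
  along level raising), S3a (Shioda's semi-decomposable supply) and S5 (eigenspace structure, Ran
  Prop. 1.7), spelled verbatim as in `…DoublingHodge` / `…FiveQPayoff`. Every Hodge character of `X⁴ₘ`
  has six entries, so its value multiset is reachable (`reach_sextuple_coprime_six`), hence claimed
  (`Doubling.claimMultiset_of_stableReach`: the lattice criterion S1 over the printed supply S3b), and
  the per-dimension transfer `hodgeConjectureFor_of_claims_dim` at `(m, 2)` applies.

This is da Silva 2021 Thm 3.3 ("HC for `X⁴ₘ`, `(m, 6) = 1`") with the classification its printed proof
silently needs — `𝔅⁴ₘ = 𝔇⁴ₘ ∪ {σ_{5,A}}` for `5 ∣ m` (Aoki 1983 Thm A′ refined at the prime `5`; the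
`σ_{5,A}`-eigenlines are algebraic by Aoki 1987 Thm 2-1, the explicit standard subvarieties) — now
SUPPLIED for `25 ∤ m`, `35 ∤ m`, modulo the printed facts S0 and the stub statements S2/S3a/S5. The two
excluded cores (`25 ∣ m`: fibres of five units; `35 ∣ m`: the prime `7` at the boundary of the room) are
the follow-up stubs of the programme; the engine S4 is not used (no residual sign class in dimension `4`
at these levels). An all-`n` wrapper is deliberately NOT here.

References: [daSilva2021HodgeFermat] G. da Silva Jr., arXiv:2101.04739, Thm. 3.3; [Aoki1983] N. Aoki,
Math. Ann. 266 (1983) Thm. A′ (§7); [Aoki1987] N. Aoki, J. Math. Soc. Japan 39 (1987) §1 p. 386–387,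
Thm. 1-1, Thm. 1-4, Thm. 2-1 (p. 388); [Shioda1979PJA] T. Shioda, Proc. Japan Acad. 55A (1979) §2 Thm. 1;
[Ran1980] Z. Ran, Compositio Math. 42 (1980) Prop. 1.7.
-/

-- every sibling file of the line declares into `…CancelByAnyClaimLattice.CoprimeSix` from a differently named module
set_option linter.dupNamespace false

noncomputable section

open Finset
open CategoryTheory AlgebraicGeometry
open Literature.AlgebraicGeometry Literature.AlgebraicGeometry.Motives Literature.AlgebraicTopology.SingularHomology
open Literature.AlgebraicGeometry.HodgeTheory Literature.AlgebraicGeometry.HodgeTheory.FermatCharacter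

namespace Summit.HodgeConjecture.HodgeConjecture.Theorems.CancelByAnyClaimLattice.CoprimeSix

/-- `Supply[M]` — the printed supply of level `M` (local notation of the line, verbatim). -/
local notation3 (prettyPrint := false) "Supply[" M "]" =>
  ({s : Multiset (ZMod M) | ∃ a : ZMod M, a ≠ 0 ∧ s = ({a, -a} : Multiset (ZMod M))} ∪
    {s : Multiset (ZMod M) | IsHodgeMultiset s ∧ Multiset.card s = 4} ∪
    {s : Multiset (ZMod M) | IsHodgeMultiset s ∧ IsSemiDecomposable s} ∪
    {s : Multiset (ZMod M) | ∃ (p : ℕ) (a : ZMod M), p.Prime ∧ p ≠ 2 ∧ p ∣ M ∧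
        2 < (M / p) / Nat.gcd (ZMod.val a) (M / p) ∧
        s = Multiset.map (fun j : ℕ => a + (j : ZMod M) * ((M / p : ℕ) : ZMod M)) (Multiset.range p) +
              {-((p : ZMod M) * a)}} : Set (Multiset (ZMod M)))

/-- `Reach[M, s]` (local notation of the line, verbatim). -/
local notation3 (prettyPrint := false) "Reach[" M ", " s "]" =>
  ∃ P N : Multiset (Multiset (ZMod M)),
    (∀ u ∈ P, u ∈ Supply[M]) ∧ (∀ u ∈ N, u ∈ Supply[M]) ∧ s + Multiset.sum N = Multiset.sum P

/-- `LevelRaise[k, m, s]` (local notation of the line, verbatim). -/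
local notation3 (prettyPrint := false) "LevelRaise[" k ", " m ", " s "]" =>
  Multiset.map (fun a : ZMod m => ((k * ZMod.val a : ℕ) : ZMod (k * m))) s

/-- `StableReach[m, s]` (local notation of the line, verbatim). -/
local notation3 (prettyPrint := false) "StableReach[" m ", " s "]" => ∃ k : ℕ, 0 < k ∧ Reach[k * m, LevelRaise[k, m, s]]

/-- The statement of stub S2↑ (pull-back of claim along level raising). Local notation only, verbatim
`…DoublingHodge`. -/
local notation3 (prettyPrint := false) "LevelClaimPull" =>
  ∀ (m k r : ℕ) (α' : Fin (2 * r + 2) → ZMod m), 0 < k → (∀ i, α' i ≠ 0) →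
    FermatCharacter.Claim m r α' → FermatCharacter.Claim (k * m) r (fun i => ((k * (α' i).val : ℕ) : ZMod (k * m)))

/-- The statement of stub S2↓ (push-forward of claim along level raising). Local notation only, verbatim
`…DoublingHodge`. -/
local notation3 (prettyPrint := false) "LevelClaimPush" =>
  ∀ (m k r : ℕ) (α' : Fin (2 * r + 2) → ZMod m), 0 < k → (∀ i, α' i ≠ 0) →
    FermatCharacter.Claim (k * m) r (fun i => ((k * (α' i).val : ℕ) : ZMod (k * m))) → FermatCharacter.Claim m r α'

/-- The statement of stub S3a (Shioda's semi-decomposable supply is claimed). Local notation only, verbatim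
`…DoublingHodge`. -/
local notation3 (prettyPrint := false) "SemiClaim" =>
  ∀ (M : ℕ) [NeZero M] (s : Multiset (ZMod M)), IsHodgeMultiset s → IsSemiDecomposable s → ClaimMultiset M s

/-- The statement of stub S5 (eigenspace structure of `H²ᵖ(X²ᵖₘ)`, Ran Prop. 1.7) at every level. Local
notation only, verbatim `…DoublingHodge`. -/
local notation3 (prettyPrint := false) "EigenStructure" =>
  ∀ (m : ℕ) [NeZero m] ⦃p : ℕ⦄, 0 < p →
    (∀ α : Fin (2 * p + 2) → ZMod m, α ≠ 0 → (∃ i, α i = 0) → fermatEigenspace m α (2 * p) = ⊥) ∧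
    (fermatEigenspace m (0 : Fin (2 * p + 2) → ZMod m) (2 * p) ≤
      LinearMap.range (complexBetti.map (SmoothHypersurface.hypersurfaceι (fermatPolynomial ℂ (2 * p) m)) (2 * p)).hom) ∧
    (∀ (A : HodgeModel (2 * p) (fermatHypersurface (2 * p) m)) (β : Fin (2 * p + 2) → ZMod m),
      (∀ i, β i ≠ 0) →
      (∃ x ∈ fermatEigenspace m β (2 * p), x ≠ 0 ∧ A.pullback (2 * p) x ∈ A.hodgePQ (2 * p) p p) →
        2 * FermatCharacter.normSum β = m * (2 * p + 2))

/-! ### §1 Symmetric multiplicities at an odd level: pairs -/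

section Classification

variable {m : ℕ} [NeZero m]

/-- **Symmetric multiplicities at a level prime to `6` split a Hodge multiset into pairs `Q + (-Q)`, `Q`
zero-free.** Strong induction on the cardinality: `IsHodgeMultiset.exists_eq_pair_add_of_count` splits off
a pair `{a, -a}` (no entry is self-paired — `a = -a` gives `2a = 0`, hence `a = 0` as `2` is a unit modulo
`m`, contradicting zero-freeness), the rest keeps symmetric multiplicities, and
`{a, -a} + (Q + (-Q)) = (a :: Q) + (-(a :: Q))`. (Aoki's `𝔇ₘ` by multiplicities.)
[cite: Aoki1987, §1 p. 386 (definition of 𝔇ⁿₘ)] -/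
theorem exists_pairs_of_count_symm (hm : m.Coprime 6) :
    ∀ (k : ℕ) (s : Multiset (ZMod m)), Multiset.card s = k → IsHodgeMultiset s →
      (∀ x : ZMod m, Multiset.count x s = Multiset.count (-x) s) →
      ∃ Q : Multiset (ZMod m), (∀ a ∈ Q, a ≠ 0) ∧ s = Q + Q.map (fun a ↦ -a) := by
  -- adapted from the lead's skeleton (generation 12, programme S16)
  intro k
  induction k using Nat.strong_induction_on with
  | _ k ih =>
  intro s hk hs hsym
  by_cases hs0 : s = 0
  · exact ⟨0, by simp, by simp [hs0]⟩
  have h2u : IsUnit ((2 : ℕ) : ZMod m) := by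
    rw [ZMod.isUnit_iff_coprime]
    exact (Nat.Coprime.coprime_dvd_right (by norm_num) hm).symm
  obtain ⟨a, t, ha, ht, rfl⟩ := hs.exists_eq_pair_add_of_count hs0 (fun x ↦ (hsym x).symm) (by
    intro a ha haa
    exfalso
    have h2 : ((2 : ℕ) : ZMod m) * a = 0 := by push_cast; linear_combination haa
    rw [h2u.mul_right_eq_zero] at h2
    exact hs.1.1 a ha h2)
  have hcard : Multiset.card t < k := by
    rw [← hk, Multiset.card_add, Multiset.card_pair]; omega
  have hsymt : ∀ x : ZMod m, Multiset.count x t = Multiset.count (-x) t := by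
    intro x
    have h := hsym x
    rw [Multiset.count_add, Multiset.count_add] at h
    have hp : Multiset.count x ({a, -a} : Multiset (ZMod m)) = Multiset.count (-x) {a, -a} := by
      simp only [Multiset.insert_eq_cons, Multiset.count_cons, Multiset.count_singleton, neg_eq_iff_eq_neg,
        neg_neg]
      rw [add_comm]
    omega
  obtain ⟨Q, hQ, rfl⟩ := ih _ hcard t rfl ht hsymt
  refine ⟨a ::ₘ Q, ?_, ?_⟩
  · intro x hx
    rcases Multiset.mem_cons.1 hx with rfl | hx
    · exact ha
    · exact hQ x hx
  · rw [Multiset.map_cons, Multiset.insert_eq_cons, ← Multiset.singleton_add, ← Multiset.singleton_add,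
      ← Multiset.singleton_add]
    abel

/-! ### §2 S16: the classification of the Hodge sextuples at a level prime to `6` -/

/-- **S16 `stub_fourfoldCoprimeSix` — THE HODGE SEXTUPLES AT A LEVEL `m` PRIME TO `6` WITH `25 ∤ m`,
`35 ∤ m`: three pairs `{a, -a}` (`a ≠ 0`), or `5 ∣ m` and Aoki's `σ_{5,A} = {A + j(m/5) : j < 5} + {-5A}`
with `5A ≠ 0`** (registered signature of line `cancel-by-any-claim-lattice`). If every residue occurs in
`s` as often as its negative, `s` is three pairs (`exists_pairs_of_count_symm`); otherwise the level
analysis S16-L2 (`PairedNull.stub_exists_fibre_of_not_paired`) gives `5 ∣ m` and four of the five points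
`A + j(m/5)` inside `s` with `5A ≠ 0`, and S16-L3 (`stub_sigmaFive_of_fibre`) forces `s = σ_{5,A}`. The
unstated lemma of da Silva 2021 Thm 3.3. [cite: Aoki1983, Thm. A′ (§7)] [cite: daSilva2021HodgeFermat, Thm. 3.3] -/
theorem stub_fourfoldCoprimeSix : ∀ {m : ℕ} [NeZero m], m.Coprime 6 → ¬ 25 ∣ m → ¬ 35 ∣ m → ∀ {s : Multiset (ZMod m)}, IsHodgeMultiset s → Multiset.card s = 6 → (∃ Q : Multiset (ZMod m), (∀ a ∈ Q, a ≠ 0) ∧ s = Q + Q.map (fun a ↦ -a)) ∨ (5 ∣ m ∧ ∃ A : ZMod m, (5 : ZMod m) * A ≠ 0 ∧ s = (Multiset.range 5).map (fun i : ℕ ↦ A + (i : ZMod m) * ((m / 5 : ℕ) : ZMod m)) + {-((5 : ZMod m) * A)}) := by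
  intro m _ hm h25 h35 s hs h6
  by_cases hsym : ∀ x : ZMod m, Multiset.count x s = Multiset.count (-x) s
  · exact Or.inl (exists_pairs_of_count_symm hm _ s rfl hs hsym)
  · push Not at hsym
    obtain ⟨h5, A, hA, hfib⟩ := PairedNull.stub_exists_fibre_of_not_paired m hm h25 h35 s hs h6 hsym
    rcases stub_sigmaFive_of_fibre m hm h5 s hs h6 A hA hfib with h | h
    · exact Or.inl h
    · exact Or.inr ⟨h5, A, hA, h⟩

/-- **The classification of the Hodge sextuples at a level prime to `6` (`25 ∤ m`, `35 ∤ m`), named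
hypotheses**: three pairs, or `5 ∣ m` and `σ_{5,A}` with `5A ≠ 0` (`stub_fourfoldCoprimeSix`).
[cite: Aoki1983, Thm. A′ (§7)] [cite: daSilva2021HodgeFermat, Thm. 3.3] -/
theorem classification (hm : m.Coprime 6) (h25 : ¬ 25 ∣ m) (h35 : ¬ 35 ∣ m) {s : Multiset (ZMod m)}
    (hs : IsHodgeMultiset s) (h6 : Multiset.card s = 6) :
    (∃ Q : Multiset (ZMod m), (∀ a ∈ Q, a ≠ 0) ∧ s = Q + Q.map (fun a ↦ -a)) ∨
      (5 ∣ m ∧ ∃ A : ZMod m, (5 : ZMod m) * A ≠ 0 ∧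
        s = (Multiset.range 5).map (fun i : ℕ ↦ A + (i : ZMod m) * ((m / 5 : ℕ) : ZMod m)) +
          {-((5 : ZMod m) * A)}) :=
  stub_fourfoldCoprimeSix hm h25 h35 hs h6

/-- **Every Hodge sextuple at a level `m` prime to `6` (`25 ∤ m`, `35 ∤ m`) is ℤ-reachable from the
printed supply at its own level**: by the classification it is three pairs or `σ_{5,A}`, and both shapes
are reachable (`stub_reach_of_pairedOrSigmaFive`: pairs are the first component of the supply, `σ_{5,A}`
the fourth with `p = 5`). [cite: Aoki1987, Thm. 1-1 and Thm. 2-1 (p. 388)] [cite: Aoki1983, Thm. A′ (§7)] -/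
theorem reach_sextuple_coprime_six (hm : m.Coprime 6) (h25 : ¬ 25 ∣ m) (h35 : ¬ 35 ∣ m)
    {s : Multiset (ZMod m)} (hs : IsHodgeMultiset s) (h6 : Multiset.card s = 6) : Reach[m, s] :=
  stub_reach_of_pairedOrSigmaFive m hm s hs h6 (stub_fourfoldCoprimeSix hm h25 h35 hs h6)

/-- **A Hodge sextuple of UNITS at a level `m` prime to `6` (`25 ∤ m`, `35 ∤ m`) is three pairs**: in the
other branch of the classification `5 ∣ m` and the entry `-5A` of `s = σ_{5,A}` would be a unit, making
`5` a unit modulo `m` — impossible. (Aoki's Thm A′ for sextuples of units, beyond `(m, 30) = 1`.)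
[cite: Aoki1983, Thm. A′ (§7)] -/
theorem allUnit_sextuple_paired (hm : m.Coprime 6) (h25 : ¬ 25 ∣ m) (h35 : ¬ 35 ∣ m)
    {s : Multiset (ZMod m)} (hs : IsHodgeMultiset s) (h6 : Multiset.card s = 6) (hu : ∀ x ∈ s, IsUnit x) :
    ∃ Q : Multiset (ZMod m), (∀ a ∈ Q, a ≠ 0) ∧ s = Q + Q.map (fun a ↦ -a) := by
  rcases stub_fourfoldCoprimeSix hm h25 h35 hs h6 with h | ⟨h5, A, _, hsA⟩
  · exact h
  · exfalso
    have hmem : -((5 : ZMod m) * A) ∈ s := by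
      rw [hsA]
      exact Multiset.mem_add.2 (Or.inr (Multiset.mem_singleton_self _))
    have h5u : IsUnit ((5 : ℕ) : ZMod m) := by
      rw [Nat.cast_ofNat]
      exact isUnit_of_mul_isUnit_left ((IsUnit.neg_iff _).1 (hu _ hmem))
    exact (ZMod.isUnit_prime_iff_not_dvd Nat.prime_five).1 h5u h5

end Classification

/-! ### §3 Pay-off: HC for the Fermat fourfolds of degree prime to `6` -/

/-- **HC FOR EVERY SMOOTH PROJECTIVE COMPLEX FERMAT FOURFOLD `X⁴ₘ` OF DEGREE `m` PRIME TO `6` WITH `25 ∤ m`,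
`35 ∤ m`**, granted the named facts Aoki 1987 Thm 1-4 (i) `hJ`, (ii) `hC`, Thm 1-1 `hP`, Thm 2-1 `hS`,
Aoki–Shioda 1983 (2.1) `hNS`, and the statements of the stubs S2↑ `hPull`, S2↓ `hPush`, S3a `h3a`, S5 `h5`
(exactly the hypotheses of `FiveQ.hodgeConjectureFor_fourfold_five_mul_prime` and of every earlier pay-off
of the line): every Hodge character `α` of `X⁴ₘ` has six entries, so its value multiset is reachable at
level `m` (`reach_sextuple_coprime_six`), hence claimed (`Doubling.claimMultiset_of_stableReach`), and the
per-dimension transfer `hodgeConjectureFor_of_claims_dim` at `(m, 2)` applies. Da Silva 2021 Thm 3.3 with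
the missing classification supplied (for `25 ∤ m`, `35 ∤ m`). [cite: daSilva2021HodgeFermat, Thm. 3.3]
[cite: Aoki1983, Thm. A′ (§7)] [cite: Aoki1987, Thm. 2-1 (p. 388)] -/
theorem hodgeConjectureFor_fourfold_coprime_six
    (hJ : Aoki1987_claim_juxtaposition) (hC : Aoki1987_claim_of_claim_juxtaposition_paired)
    (hP : Shioda_claim_paired) (hNS : AokiShioda1983_eigenline_le_neronSeveri) (hS : Aoki1987_claim_pStandard)
    (hPull : LevelClaimPull) (hPush : LevelClaimPush) (h3a : SemiClaim) (h5 : EigenStructure)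
    {m : ℕ} [NeZero m] (hm : m.Coprime 6) (h25 : ¬ 25 ∣ m) (h35 : ¬ 35 ∣ m)
    ⦃X : SchemeOver ℂ⦄ (hF : IsFermatVariety 4 m X) (hX : IsSmoothProjective 4 X) :
    HodgeConjectureFor 4 X := by
  refine hodgeConjectureFor_of_claims_dim (m := m) (p := 2) two_pos (h5 m two_pos).1
    (h5 m two_pos).2.1 (h5 m two_pos).2.2 (fun α hα ↦ ?_) hF hX
  have hs : IsHodgeMultiset (univ.val.map α) := hα.isHodgeMultiset
  have hcard : Multiset.card (univ.val.map α) = 6 := by rw [card_univ_val_map]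
  have hs0 : univ.val.map α ≠ 0 := fun h0 ↦ by
    have h := congrArg Multiset.card h0
    rw [hcard, Multiset.card_zero] at h
    exact absurd h (by norm_num)
  have hR : Reach[m, univ.val.map α] := reach_sextuple_coprime_six hm h25 h35 hs hcard
  exact (claimMultiset_univ_val_map_iff α).1
    (Doubling.claimMultiset_of_stableReach hJ hC hP hNS hS hPull hPush h3a hs0 hs
      (Doubling.stableReach_of_reach hR))

end Summit.HodgeConjecture.HodgeConjecture.Theorems.CancelByAnyClaimLattice.CoprimeSix

end
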